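import Summits.QuantumAdvantage.QuantumAdvantage.Theorems.CubicForrelationNearExactIsExactCubicFormR2Partner
import Summits.QuantumAdvantage.QuantumAdvantage.Theorems.CubicForrelationNearExactIsExactCubicFormR2PartnerHyperplane

/-!
# Crux `CubicForrelation.NearExactIsExact` (stmt-QuantumAdvantage-14043) — E1280-even: the branch statement `HR2` FROM the per-rank levels
  `HL 1..4` and the exceptional level `HEXC`

Certificate seat `b2b-cforr-cert` (gen 42).  HONEST FRAMING: kernel-checked glue (standard axioms).  `HR2` is the first hypothesis of
`tpw_weight_ge_1280_of_branches` / `theta_twelve_eq_57_64_of_branches`; here it is reduced to the five light-cell endgames of R2-PARTNER §4: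
`HL 1` (`T`), `HL 2` (`s₀ω₄`), `HL 3` (`s₀ω₆`), `HL 4` (`s₀ω₈`) — in the normal coordinates of `tpw_R2_hyperplane_of_levels` — and `HEXC`
(`T⊕T′`, the weight-`112` non-hyperplane word).  Chain: `tpw_R2_partner_frame` (adapted frame on `3 + 9 = 6 + 6` bits) →
`tpw_R2_frame_false_of_branches` (cells, zero descendant, K–T dispatch) → `tpw_R2_hyperplane_of_levels`.  The five endgames remain TO BE
PROVED; nothing about `θ₁₂` changes; NOT summit progress.

* `tpw_HR2_of_levels`: `(∀ h, HL h) → HEXC → HR2`.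
-/

set_option linter.dupNamespace false -- D-0017: single-problem summit ⇒ `QuantumAdvantage.QuantumAdvantage` by design

namespace Summit.QuantumAdvantage.QuantumAdvantage.Theorems.CubicForrelation.NearExactIsExact

open Finset
open Literature.Computability.QuantumComplexity
open Literature.Computability.QuantumComplexity.BuzetChailloux (bxor zeroVec bxor_comm bxor_self bxor_zeroVec zeroVec_bxor
  bxor_bxor_cancel_left)

/-- **`HR2` from the light-cell levels.**  See the module docstring.  NOT summit progress: `HL`, `HEXC` are not yet kernel theorems.
[this work] -/
theorem tpw_HR2_of_levels
    (HL : ∀ (h : ℕ) (hk : 1 + h + h ≤ 9), 1 ≤ h →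
      ∀ (κ : (Fin (3 + 9) → Bool) → Bool), IsDegLeFun 3 κ →
      ∀ (c d : Fin (3 + 9) → Fin (3 + 9) → Fin (3 + 9) → ZMod 2),
      (∀ p j k, c p k j = c p j k) → (∀ p j k, c j p k = c p j k) → (∀ p j, c p j j = 0) →
      (∀ φ j k, d φ k j = d φ j k) → (∀ φ j k, d j φ k = d φ j k) → (∀ φ j, d φ j j = 0) →
      (∀ φ j k, d φ j k =
        if ((((κ zeroVec ^^ κ (bxor zeroVec (fun l => decide (l = k)))) ^^
                (κ (bxor zeroVec (fun l => decide (l = j))) ^^ κ (bxor (bxor zeroVec (fun l => decide (l = j))) (fun l => decide (l = k))))) ^^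
              ((κ (bxor zeroVec (fun l => decide (l = φ))) ^^ κ (bxor (bxor zeroVec (fun l => decide (l = φ))) (fun l => decide (l = k)))) ^^
                (κ (bxor (bxor zeroVec (fun l => decide (l = φ))) (fun l => decide (l = j))) ^^
                  κ (bxor (bxor (bxor zeroVec (fun l => decide (l = φ))) (fun l => decide (l = j))) (fun l => decide (l = k))))))) = true
        then 1 else 0) →
      (∀ p φ, (∑ j, ∑ k, (if j < k then c p j k * d φ j k else 0)) = if p = φ then 1 else 0) →
      (∀ y, (κ y ^^ κ (bxor y (fun l => decide (l = Fin.castAdd 9 (0 : Fin 3))))) =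
        (y (Fin.castAdd 9 (1 : Fin 3)) && y (Fin.castAdd 9 (2 : Fin 3)))) →
      (∀ j k, d (Fin.castAdd 9 0) j k =
        if (j = Fin.castAdd 9 1 ∧ k = Fin.castAdd 9 2) ∨ (j = Fin.castAdd 9 2 ∧ k = Fin.castAdd 9 1) then 1 else 0) →
      #(univ.filter fun s : Fin 9 → Bool => κ (Fin.append ![false, false, false] s) = true) +
        #(univ.filter fun s : Fin 9 → Bool => κ (Fin.append ![false, false, true] s) = true) +
        #(univ.filter fun s : Fin 9 → Bool => κ (Fin.append ![false, true, false] s) = true) < 384 →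
      ∀ (i j : Bool), (i && j) = false →
      (∀ i' j' : Bool, (i' && j') = false →
        #(univ.filter fun s : Fin 9 → Bool => κ (Fin.append ![false, i, j] s) = true) ≤
          #(univ.filter fun s : Fin 9 → Bool => κ (Fin.append ![false, i', j'] s) = true)) →
      0 < #(univ.filter fun s : Fin 9 → Bool => κ (Fin.append ![false, i, j] s) = true) →
      4 * #(univ.filter fun s : Fin 9 → Bool => κ (Fin.append ![false, i, j] s) = true) + 2 ^ (9 - h) = 2 ^ 9 →
      ∀ (bz : Bool), (∀ s : Fin 9 → Bool, κ (Fin.append ![false, i, j] s) = true → s (Fin.castLE hk (Fin.castAdd h (Fin.castAdd h (0 : Fin 1)))) = bz) →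
      (∀ u v w x : Fin 9 → Bool,
        ((((κ (Fin.append ![false, i, j] x) ^^ κ (Fin.append ![false, i, j] (bxor x w))) ^^
              (κ (Fin.append ![false, i, j] (bxor x v)) ^^ κ (Fin.append ![false, i, j] (bxor (bxor x v) w)))) ^^
            ((κ (Fin.append ![false, i, j] (bxor x u)) ^^ κ (Fin.append ![false, i, j] (bxor (bxor x u) w))) ^^
              (κ (Fin.append ![false, i, j] (bxor (bxor x u) v)) ^^
                κ (Fin.append ![false, i, j] (bxor (bxor (bxor x u) v) w)))))) =
        ((((u (Fin.castLE hk (Fin.castAdd h (Fin.castAdd h (0 : Fin 1)))) &&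
            decide ((∑ ii : Fin h, ((if v (Fin.castLE hk (Fin.castAdd h (Fin.natAdd 1 ii))) = true then (1 : ZMod 2) else 0) * (if w (Fin.castLE hk (Fin.natAdd (1 + h) ii)) = true then (1 : ZMod 2) else 0) +
              (if v (Fin.castLE hk (Fin.natAdd (1 + h) ii)) = true then (1 : ZMod 2) else 0) * (if w (Fin.castLE hk (Fin.castAdd h (Fin.natAdd 1 ii))) = true then (1 : ZMod 2) else 0))) = 1)) ^^
          (v (Fin.castLE hk (Fin.castAdd h (Fin.castAdd h (0 : Fin 1)))) &&
            decide ((∑ ii : Fin h, ((if u (Fin.castLE hk (Fin.castAdd h (Fin.natAdd 1 ii))) = true then (1 : ZMod 2) else 0) * (if w (Fin.castLE hk (Fin.natAdd (1 + h) ii)) = true then (1 : ZMod 2) else 0) +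
              (if u (Fin.castLE hk (Fin.natAdd (1 + h) ii)) = true then (1 : ZMod 2) else 0) * (if w (Fin.castLE hk (Fin.castAdd h (Fin.natAdd 1 ii))) = true then (1 : ZMod 2) else 0))) = 1))) ^^
          (w (Fin.castLE hk (Fin.castAdd h (Fin.castAdd h (0 : Fin 1)))) &&
            decide ((∑ ii : Fin h, ((if u (Fin.castLE hk (Fin.castAdd h (Fin.natAdd 1 ii))) = true then (1 : ZMod 2) else 0) * (if v (Fin.castLE hk (Fin.natAdd (1 + h) ii)) = true then (1 : ZMod 2) else 0) +
              (if u (Fin.castLE hk (Fin.natAdd (1 + h) ii)) = true then (1 : ZMod 2) else 0) * (if v (Fin.castLE hk (Fin.castAdd h (Fin.natAdd 1 ii))) = true then (1 : ZMod 2) else 0))) = 1))))) → False)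
    (HEXC :
      ∀ (κ : (Fin (3 + 9) → Bool) → Bool), IsDegLeFun 3 κ →
      ∀ (c d : Fin (3 + 9) → Fin (3 + 9) → Fin (3 + 9) → ZMod 2),
      (∀ p j k, c p k j = c p j k) → (∀ p j k, c j p k = c p j k) → (∀ p j, c p j j = 0) →
      (∀ φ j k, d φ k j = d φ j k) → (∀ φ j k, d j φ k = d φ j k) → (∀ φ j, d φ j j = 0) →
      (∀ φ j k, d φ j k =
        if ((((κ zeroVec ^^ κ (bxor zeroVec (fun l => decide (l = k)))) ^^
                (κ (bxor zeroVec (fun l => decide (l = j))) ^^ κ (bxor (bxor zeroVec (fun l => decide (l = j))) (fun l => decide (l = k))))) ^^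
              ((κ (bxor zeroVec (fun l => decide (l = φ))) ^^ κ (bxor (bxor zeroVec (fun l => decide (l = φ))) (fun l => decide (l = k)))) ^^
                (κ (bxor (bxor zeroVec (fun l => decide (l = φ))) (fun l => decide (l = j))) ^^
                  κ (bxor (bxor (bxor zeroVec (fun l => decide (l = φ))) (fun l => decide (l = j))) (fun l => decide (l = k))))))) = true
        then 1 else 0) →
      (∀ p φ, (∑ j, ∑ k, (if j < k then c p j k * d φ j k else 0)) = if p = φ then 1 else 0) →
      (∀ y, (κ y ^^ κ (bxor y (fun l => decide (l = Fin.castAdd 9 (0 : Fin 3))))) =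
        (y (Fin.castAdd 9 (1 : Fin 3)) && y (Fin.castAdd 9 (2 : Fin 3)))) →
      (∀ j k, d (Fin.castAdd 9 0) j k =
        if (j = Fin.castAdd 9 1 ∧ k = Fin.castAdd 9 2) ∨ (j = Fin.castAdd 9 2 ∧ k = Fin.castAdd 9 1) then 1 else 0) →
      #(univ.filter fun s : Fin 9 → Bool => κ (Fin.append ![false, false, false] s) = true) +
        #(univ.filter fun s : Fin 9 → Bool => κ (Fin.append ![false, false, true] s) = true) +
        #(univ.filter fun s : Fin 9 → Bool => κ (Fin.append ![false, true, false] s) = true) < 384 →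
      ∀ (i j : Bool), (i && j) = false →
      (∀ i' j' : Bool, (i' && j') = false →
        #(univ.filter fun s : Fin 9 → Bool => κ (Fin.append ![false, i, j] s) = true) ≤
          #(univ.filter fun s : Fin 9 → Bool => κ (Fin.append ![false, i', j'] s) = true)) →
      0 < #(univ.filter fun s : Fin 9 → Bool => κ (Fin.append ![false, i, j] s) = true) →
      32 * #(univ.filter fun s : Fin 9 → Bool => κ (Fin.append ![false, i, j] s) = true) = 7 * 2 ^ 9 →
      (¬ ∃ (z : Fin 9 → Bool) (b : Bool), z ≠ zeroVec ∧
        ∀ s, κ (Fin.append ![false, i, j] s) = true → decide (Odd #(univ.filter fun l => (s l && z l) = true)) = b) → False) :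
    ∀ (κ : (Fin (6 + 6) → Bool) → Bool), IsDegLeFun 3 κ →
      ∀ (c d : Fin (6 + 6) → Fin (6 + 6) → Fin (6 + 6) → ZMod 2),
      (∀ p j k, c p k j = c p j k) → (∀ p j k, c j p k = c p j k) → (∀ p j, c p j j = 0) →
      (∀ φ j k, d φ j k =
        if ((((κ zeroVec ^^ κ (bxor zeroVec (fun l => decide (l = k)))) ^^
                (κ (bxor zeroVec (fun l => decide (l = j))) ^^ κ (bxor (bxor zeroVec (fun l => decide (l = j))) (fun l => decide (l = k))))) ^^
              ((κ (bxor zeroVec (fun l => decide (l = φ))) ^^ κ (bxor (bxor zeroVec (fun l => decide (l = φ))) (fun l => decide (l = k)))) ^^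
                (κ (bxor (bxor zeroVec (fun l => decide (l = φ))) (fun l => decide (l = j))) ^^
                  κ (bxor (bxor (bxor zeroVec (fun l => decide (l = φ))) (fun l => decide (l = j))) (fun l => decide (l = k))))))) = true
        then 1 else 0) →
      (∀ p φ, (∑ j, ∑ k, (if j < k then c p j k * d φ j k else 0)) = if p = φ then 1 else 0) →
      ∀ a : Fin (6 + 6) → Bool, a ≠ zeroVec → #(univ.filter fun x => (κ x ^^ κ (bxor x a)) = true) = 1024 →
      1280 ≤ #(univ.filter fun x : Fin (6 + 6) → Bool => κ x = true) := by
  intro κ hκ c d hcs hcc hcd hd hpair a ha hDa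
  by_contra hlt
  obtain ⟨hds, -, hdd⟩ := tpw_d_symm κ d hd
  -- `Fin (6 + 6)` is `Fin (3 + 9)`: read the data on `3 + 9` bits
  have hDa' : #(univ.filter fun x : Fin (3 + 9) → Bool => (κ x ^^ κ (bxor x a)) = true) = 2 ^ (9 + 1) := by
    rw [show (2 : ℕ) ^ (9 + 1) = 1024 by norm_num]
    exact hDa
  obtain ⟨κ', c', d', hκ'3, hcard, hcs', hcc', hcd', hd'T, hpair', hD0', hF1'⟩ :=
    tpw_R2_partner_frame (m := 9) κ hκ c d hcs hcc hcd hds hdd hd hpair a ha hDa'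
  obtain ⟨hds', hdc', hdd'⟩ := tpw_d_symm κ' d' hd'T
  have hlt' : #(univ.filter fun y : Fin (3 + 9) → Bool => κ' y = true) < 1280 := by
    rw [hcard]
    have : #(univ.filter fun x : Fin (3 + 9) → Bool => κ x = true) = #(univ.filter fun x : Fin (6 + 6) → Bool => κ x = true) := rfl
    rw [this]
    omega
  exact tpw_R2_frame_false_of_branches (tpw_R2_hyperplane_of_levels HL) HEXC κ' hκ'3 c' d' hcs' hcc' hcd' hds' hdc' hdd' hd'T hpair'
    hD0' hF1' hlt'

end Summit.QuantumAdvantage.QuantumAdvantage.Theorems.CubicForrelation.NearExactIsExact
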